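import Summits.NavierStokesRegularity.NavierStokesRegularity.Theorems.ExtremiserTransienceNearExtremalTransienceExtremiserLiouvilleConstantSpeedGlobalVariation
import Literature.Analysis.FluidPDE.CheskidovAssemblyTools
import Literature.Analysis.FluidPDE.NSVorticityBKMProofs
import HarnessLib

/-!
# Crux `ExtremiserTransience.NearExtremalTransience` (stmt-NavierStokesRegularity-21883), line `extremiser_liouville`,
# stub K1b — the first variations `a₁`, `J₁` are LIPSCHITZ in the gradient of the direction (blueprint L4, tools)

`--supports stmt-NavierStokesRegularity-21883` (helper).  Author: prover seat `ns-el-k1b` (g8).  Record: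
`Cruxes/NearExtremalTransience/Lines/extremiser_liouville_k1b_slide.md` §12 (iv′).

To pass to the limit `h → 0⁺` in `slideKKT` (`ℓ(−h⁻¹φ̂_h) ≤ 0`) one needs that the enstrophy and stretching variations
`a₁(θ) = ∫⟪ω, curl θ⟫`, `J₁(θ) = ∫⟪curl θ, Dv ω⟫ + ⟪ω, Dθ ω⟫ + ⟪ω, Dv curl θ⟫` (`ω = curl v`, `‖Dv‖ ≤ B`, `ω ∈ L²`) are
controlled by `‖Dθ‖_{L²}` — then `h⁻¹Dφ̂_h → Dφ_g` in `L²` (`…SlideQuotientLimit`) carries `a₁`, `J₁` to the limit: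
* `norm_curl_le_four_mul` : `‖curl θ(x)‖ ≤ 4‖Dθ(x)‖`;
* `abs_firstVar_enstrophy_le` : **`|a₁(θ)| ≤ 4·√Z·‖Dθ‖_{L²}`** (`Z = ∫‖ω‖²`);
* `abs_firstVar_stretching_le` : **`|J₁(θ)| ≤ 12·B·√Z·‖Dθ‖_{L²}`**.
(The palinstrophy variation `c₁` is NOT Lipschitz in `‖Dθ‖_{L²}` — it needs `D²θ`; its limit goes through the discrete product
rule `…DiscreteProductRule`, record §12 (v).)

WHAT THIS IS NOT: K1b is NOT proved; nothing here proves NS regularity. [folklore]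
-/

noncomputable section

open Set Filter Topology MeasureTheory Metric Function InnerProductSpace
open scoped ENNReal NNReal Topology InnerProductSpace RealInnerProductSpace ContDiff
open Literature.Analysis.FluidPDE Literature.Analysis

namespace Summit.NavierStokesRegularity.NavierStokesRegularity.Theorems

-- the problem directory repeats the summit name (`NavierStokesRegularity/NavierStokesRegularity`)
set_option linter.dupNamespace false

namespace ExtremiserLiouville

open DepletionLadder.KStar

variable {v θ : EuclideanSpace ℝ (Fin 3) → EuclideanSpace ℝ (Fin 3)}

/-- `‖curl θ(x)‖ ≤ 4‖Dθ(x)‖`. [folklore] -/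
theorem norm_curl_le_four_mul (θ : EuclideanSpace ℝ (Fin 3) → EuclideanSpace ℝ (Fin 3)) (x : EuclideanSpace ℝ (Fin 3)) :
    ‖curl θ x‖ ≤ 4 * ‖fderiv ℝ θ x‖ := by
  rw [curl_eq_curlCLM]
  exact (curlCLM.le_opNorm _).trans (mul_le_mul_of_nonneg_right norm_curlCLM_le_four (norm_nonneg _))

/-- `√(∫‖curl θ‖²) ≤ 4√(∫‖Dθ‖²)` when `Dθ ∈ L²`. [folklore] -/
theorem sqrt_integral_norm_curl_sq_le
    (hD : Integrable (fun x => ‖fderiv ℝ θ x‖ ^ 2) (volume : Measure (EuclideanSpace ℝ (Fin 3)))) :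
    Real.sqrt (∫ x, ‖curl θ x‖ ^ 2) ≤ 4 * Real.sqrt (∫ x, ‖fderiv ℝ θ x‖ ^ 2) := by
  have hle : (∫ x, ‖curl θ x‖ ^ 2) ≤ ∫ x, 16 * ‖fderiv ℝ θ x‖ ^ 2 := by
    refine integral_mono_of_nonneg (Eventually.of_forall fun x => sq_nonneg _) (hD.const_mul 16)
      (Eventually.of_forall fun x => ?_)
    have h := norm_curl_le_four_mul θ x
    have h0 := norm_nonneg (curl θ x)
    nlinarith
  rw [integral_const_mul] at hle
  calc Real.sqrt (∫ x, ‖curl θ x‖ ^ 2) ≤ Real.sqrt (16 * ∫ x, ‖fderiv ℝ θ x‖ ^ 2) := Real.sqrt_le_sqrt hle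
    _ = 4 * Real.sqrt (∫ x, ‖fderiv ℝ θ x‖ ^ 2) := by
        rw [Real.sqrt_mul (by norm_num), show Real.sqrt 16 = 4 by rw [show (16 : ℝ) = 4 ^ 2 by norm_num, Real.sqrt_sq (by norm_num)]]

/-- `MemLp` bookkeeping: a continuous field dominated by `K‖g‖` with `‖g‖²` integrable is in `L²`. [folklore] -/
theorem memLp_two_of_norm_le_mul {F G : Type*} [NormedAddCommGroup F] [NormedAddCommGroup G]
    {f : EuclideanSpace ℝ (Fin 3) → F} {g : EuclideanSpace ℝ (Fin 3) → G} (hf : Continuous f) (hg : Continuous g)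
    (hg2 : Integrable (fun x => ‖g x‖ ^ 2) (volume : Measure (EuclideanSpace ℝ (Fin 3)))) {K : ℝ}
    (hle : ∀ x, ‖f x‖ ≤ K * ‖g x‖) : MemLp f 2 (volume : Measure (EuclideanSpace ℝ (Fin 3))) := by
  have hgm : MemLp g 2 (volume : Measure (EuclideanSpace ℝ (Fin 3))) :=
    (memLp_two_iff_integrable_sq_norm hg.aestronglyMeasurable).2 hg2
  exact MemLp.of_le_mul (c := K) hgm hf.aestronglyMeasurable (Eventually.of_forall hle)

/-- `∫‖f‖² = ‖f‖²_{L²}` bookkeeping: for `f ∈ L²` (as `MemLp`), `‖f‖²` is integrable. [folklore] -/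
theorem integrable_sq_of_memLp_two {F : Type*} [NormedAddCommGroup F] {f : EuclideanSpace ℝ (Fin 3) → F}
    (hf : MemLp f 2 (volume : Measure (EuclideanSpace ℝ (Fin 3)))) :
    Integrable (fun x => ‖f x‖ ^ 2) (volume : Measure (EuclideanSpace ℝ (Fin 3))) :=
  (memLp_two_iff_integrable_sq_norm hf.1).1 hf

/-- **`a₁` is Lipschitz in `Dθ`**: `|∫⟪curl v, curl θ⟫| ≤ 4·√(∫‖curl v‖²)·√(∫‖Dθ‖²)`. [folklore] -/
theorem abs_firstVar_enstrophy_le (hv : ContDiff ℝ 1 v) (hθ : ContDiff ℝ 1 θ)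
    (hZ : Integrable (fun x => ‖curl v x‖ ^ 2) (volume : Measure (EuclideanSpace ℝ (Fin 3))))
    (hD : Integrable (fun x => ‖fderiv ℝ θ x‖ ^ 2) (volume : Measure (EuclideanSpace ℝ (Fin 3)))) :
    |∫ x, ⟪curl v x, curl θ x⟫| ≤ 4 * Real.sqrt (∫ x, ‖curl v x‖ ^ 2) * Real.sqrt (∫ x, ‖fderiv ℝ θ x‖ ^ 2) := by
  have cω : Continuous (curl v) := continuous_curl hv
  have cθ : Continuous (curl θ) := continuous_curl hθ
  have cD : Continuous (fderiv ℝ θ) := hθ.continuous_fderiv one_ne_zero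
  have mω : MemLp (curl v) 2 (volume : Measure (EuclideanSpace ℝ (Fin 3))) :=
    (memLp_two_iff_integrable_sq_norm cω.aestronglyMeasurable).2 hZ
  have mθ : MemLp (curl θ) 2 (volume : Measure (EuclideanSpace ℝ (Fin 3))) :=
    memLp_two_of_norm_le_mul cθ cD hD (norm_curl_le_four_mul θ)
  have h1 := abs_integral_inner_le_sqrt_mul_sqrt mω mθ
  have h2 := sqrt_integral_norm_curl_sq_le hD
  have hZ0 : 0 ≤ Real.sqrt (∫ x, ‖curl v x‖ ^ 2) := Real.sqrt_nonneg _
  calc |∫ x, ⟪curl v x, curl θ x⟫| ≤ Real.sqrt (∫ x, ‖curl v x‖ ^ 2) * Real.sqrt (∫ x, ‖curl θ x‖ ^ 2) := h1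
    _ ≤ Real.sqrt (∫ x, ‖curl v x‖ ^ 2) * (4 * Real.sqrt (∫ x, ‖fderiv ℝ θ x‖ ^ 2)) := mul_le_mul_of_nonneg_left h2 hZ0
    _ = 4 * Real.sqrt (∫ x, ‖curl v x‖ ^ 2) * Real.sqrt (∫ x, ‖fderiv ℝ θ x‖ ^ 2) := by ring

/-- **`J₁` is Lipschitz in `Dθ`**: with `‖Dv‖ ≤ B`,
`|∫(⟪curl θ, Dv ω⟫ + ⟪ω, Dθ ω⟫ + ⟪ω, Dv curl θ⟫)| ≤ 12·B·√(∫‖ω‖²)·√(∫‖Dθ‖²)` (`ω = curl v`, `‖ω‖ ≤ 4B`). [folklore] -/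
theorem abs_firstVar_stretching_le (hv : ContDiff ℝ 1 v) (hθ : ContDiff ℝ 1 θ) {B : ℝ} (hB : ∀ x, ‖fderiv ℝ v x‖ ≤ B)
    (hZ : Integrable (fun x => ‖curl v x‖ ^ 2) (volume : Measure (EuclideanSpace ℝ (Fin 3))))
    (hD : Integrable (fun x => ‖fderiv ℝ θ x‖ ^ 2) (volume : Measure (EuclideanSpace ℝ (Fin 3)))) :
    |∫ x, (⟪curl θ x, fderiv ℝ v x (curl v x)⟫ + ⟪curl v x, fderiv ℝ θ x (curl v x)⟫ +
        ⟪curl v x, fderiv ℝ v x (curl θ x)⟫)| ≤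
      12 * B * Real.sqrt (∫ x, ‖curl v x‖ ^ 2) * Real.sqrt (∫ x, ‖fderiv ℝ θ x‖ ^ 2) := by
  have cω : Continuous (curl v) := continuous_curl hv
  have cθ : Continuous (curl θ) := continuous_curl hθ
  have cDv : Continuous (fderiv ℝ v) := hv.continuous_fderiv one_ne_zero
  have cD : Continuous (fderiv ℝ θ) := hθ.continuous_fderiv one_ne_zero
  have hB0 : 0 ≤ B := (norm_nonneg _).trans (hB 0)
  have hω : ∀ x, ‖curl v x‖ ≤ 4 * B := fun x =>
    (norm_curl_le_four_mul v x).trans (mul_le_mul_of_nonneg_left (hB x) (by norm_num))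
  set Z : ℝ := ∫ x, ‖curl v x‖ ^ 2 with hZdef
  set D : ℝ := ∫ x, ‖fderiv ℝ θ x‖ ^ 2 with hDdef
  have mω : MemLp (curl v) 2 (volume : Measure (EuclideanSpace ℝ (Fin 3))) :=
    (memLp_two_iff_integrable_sq_norm cω.aestronglyMeasurable).2 hZ
  have mθ : MemLp (curl θ) 2 (volume : Measure (EuclideanSpace ℝ (Fin 3))) :=
    memLp_two_of_norm_le_mul cθ cD hD (norm_curl_le_four_mul θ)
  -- the three `L²` partners
  have mDvω : MemLp (fun x => fderiv ℝ v x (curl v x)) 2 (volume : Measure (EuclideanSpace ℝ (Fin 3))) :=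
    memLp_two_of_norm_le_mul (cDv.clm_apply cω) cω hZ fun x =>
      ((fderiv ℝ v x).le_opNorm _).trans (mul_le_mul_of_nonneg_right (hB x) (norm_nonneg _))
  have mDθω : MemLp (fun x => fderiv ℝ θ x (curl v x)) 2 (volume : Measure (EuclideanSpace ℝ (Fin 3))) :=
    memLp_two_of_norm_le_mul (cD.clm_apply cω) cD hD fun x => by
      rw [mul_comm]; exact ((fderiv ℝ θ x).le_opNorm _).trans (mul_le_mul_of_nonneg_left (hω x) (norm_nonneg _))
  have hvθ : ∀ x, ‖fderiv ℝ v x (curl θ x)‖ ≤ (4 * B) * ‖fderiv ℝ θ x‖ := fun x =>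
    calc ‖fderiv ℝ v x (curl θ x)‖ ≤ ‖fderiv ℝ v x‖ * ‖curl θ x‖ := (fderiv ℝ v x).le_opNorm _
      _ ≤ B * (4 * ‖fderiv ℝ θ x‖) := mul_le_mul (hB x) (norm_curl_le_four_mul θ x) (norm_nonneg _) hB0
      _ = (4 * B) * ‖fderiv ℝ θ x‖ := by ring
  have mDvθ : MemLp (fun x => fderiv ℝ v x (curl θ x)) 2 (volume : Measure (EuclideanSpace ℝ (Fin 3))) :=
    memLp_two_of_norm_le_mul (cDv.clm_apply cθ) cD hD hvθ
  -- square-root sizes of the partners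
  have hsq1 : Real.sqrt (∫ x, ‖fderiv ℝ v x (curl v x)‖ ^ 2) ≤ B * Real.sqrt Z := by
    have hle : (∫ x, ‖fderiv ℝ v x (curl v x)‖ ^ 2) ≤ ∫ x, B ^ 2 * ‖curl v x‖ ^ 2 := by
      refine integral_mono_of_nonneg (Eventually.of_forall fun x => sq_nonneg _) (hZ.const_mul _)
        (Eventually.of_forall fun x => ?_)
      have h := ((fderiv ℝ v x).le_opNorm (curl v x)).trans (mul_le_mul_of_nonneg_right (hB x) (norm_nonneg _))
      have h0 := norm_nonneg (fderiv ℝ v x (curl v x))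
      calc ‖fderiv ℝ v x (curl v x)‖ ^ 2 ≤ (B * ‖curl v x‖) ^ 2 := pow_le_pow_left₀ h0 h 2
        _ = B ^ 2 * ‖curl v x‖ ^ 2 := by ring
    rw [integral_const_mul] at hle
    calc Real.sqrt (∫ x, ‖fderiv ℝ v x (curl v x)‖ ^ 2) ≤ Real.sqrt (B ^ 2 * Z) := Real.sqrt_le_sqrt hle
      _ = B * Real.sqrt Z := by rw [Real.sqrt_mul (sq_nonneg _), Real.sqrt_sq hB0]
  have hsq2 : Real.sqrt (∫ x, ‖fderiv ℝ θ x (curl v x)‖ ^ 2) ≤ 4 * B * Real.sqrt D := by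
    have hle : (∫ x, ‖fderiv ℝ θ x (curl v x)‖ ^ 2) ≤ ∫ x, (4 * B) ^ 2 * ‖fderiv ℝ θ x‖ ^ 2 := by
      refine integral_mono_of_nonneg (Eventually.of_forall fun x => sq_nonneg _) (hD.const_mul _)
        (Eventually.of_forall fun x => ?_)
      have h : ‖fderiv ℝ θ x (curl v x)‖ ≤ (4 * B) * ‖fderiv ℝ θ x‖ := by
        rw [mul_comm]; exact ((fderiv ℝ θ x).le_opNorm _).trans (mul_le_mul_of_nonneg_left (hω x) (norm_nonneg _))
      have h0 := norm_nonneg (fderiv ℝ θ x (curl v x))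
      calc ‖fderiv ℝ θ x (curl v x)‖ ^ 2 ≤ ((4 * B) * ‖fderiv ℝ θ x‖) ^ 2 := pow_le_pow_left₀ h0 h 2
        _ = (4 * B) ^ 2 * ‖fderiv ℝ θ x‖ ^ 2 := by ring
    rw [integral_const_mul] at hle
    calc Real.sqrt (∫ x, ‖fderiv ℝ θ x (curl v x)‖ ^ 2) ≤ Real.sqrt ((4 * B) ^ 2 * D) := Real.sqrt_le_sqrt hle
      _ = 4 * B * Real.sqrt D := by rw [Real.sqrt_mul (sq_nonneg _), Real.sqrt_sq (by positivity)]
  have hsq3 : Real.sqrt (∫ x, ‖fderiv ℝ v x (curl θ x)‖ ^ 2) ≤ 4 * B * Real.sqrt D := by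
    have hle : (∫ x, ‖fderiv ℝ v x (curl θ x)‖ ^ 2) ≤ ∫ x, (4 * B) ^ 2 * ‖fderiv ℝ θ x‖ ^ 2 := by
      refine integral_mono_of_nonneg (Eventually.of_forall fun x => sq_nonneg _) (hD.const_mul _)
        (Eventually.of_forall fun x => ?_)
      have h : ‖fderiv ℝ v x (curl θ x)‖ ≤ (4 * B) * ‖fderiv ℝ θ x‖ := hvθ x
      have h0 := norm_nonneg (fderiv ℝ v x (curl θ x))
      calc ‖fderiv ℝ v x (curl θ x)‖ ^ 2 ≤ ((4 * B) * ‖fderiv ℝ θ x‖) ^ 2 := pow_le_pow_left₀ h0 h 2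
        _ = (4 * B) ^ 2 * ‖fderiv ℝ θ x‖ ^ 2 := by ring
    rw [integral_const_mul] at hle
    calc Real.sqrt (∫ x, ‖fderiv ℝ v x (curl θ x)‖ ^ 2) ≤ Real.sqrt ((4 * B) ^ 2 * D) := Real.sqrt_le_sqrt hle
      _ = 4 * B * Real.sqrt D := by rw [Real.sqrt_mul (sq_nonneg _), Real.sqrt_sq (by positivity)]
  have hcθ : Real.sqrt (∫ x, ‖curl θ x‖ ^ 2) ≤ 4 * Real.sqrt D := sqrt_integral_norm_curl_sq_le hD
  -- the three pairings
  have iab : ∀ {a b : EuclideanSpace ℝ (Fin 3) → EuclideanSpace ℝ (Fin 3)},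
      MemLp a 2 (volume : Measure (EuclideanSpace ℝ (Fin 3))) → MemLp b 2 (volume : Measure (EuclideanSpace ℝ (Fin 3))) →
      Continuous a → Continuous b →
      Integrable (fun x => ⟪a x, b x⟫) (volume : Measure (EuclideanSpace ℝ (Fin 3))) := by
    intro a b ha hb ca cb
    exact (ha.norm.integrable_mul hb.norm).mono' (ca.inner cb).aestronglyMeasurable
      (Eventually.of_forall fun x => by rw [Real.norm_eq_abs]; exact abs_real_inner_le_norm _ _)
  have i1 := iab mθ mDvω cθ (cDv.clm_apply cω)
  have i2 := iab mω mDθω cω (cD.clm_apply cω)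
  have i3 := iab mω mDvθ cω (cDv.clm_apply cθ)
  have i12 : Integrable (fun x => ⟪curl θ x, fderiv ℝ v x (curl v x)⟫ + ⟪curl v x, fderiv ℝ θ x (curl v x)⟫)
      (volume : Measure (EuclideanSpace ℝ (Fin 3))) := i1.add i2
  rw [integral_add i12 i3, integral_add i1 i2]
  have b1 := abs_integral_inner_le_sqrt_mul_sqrt mθ mDvω
  have b2 := abs_integral_inner_le_sqrt_mul_sqrt mω mDθω
  have b3 := abs_integral_inner_le_sqrt_mul_sqrt mω mDvθ
  have hZ0 : 0 ≤ Real.sqrt Z := Real.sqrt_nonneg _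
  have hD0 : 0 ≤ Real.sqrt D := Real.sqrt_nonneg _
  have e1 : |∫ x, ⟪curl θ x, fderiv ℝ v x (curl v x)⟫| ≤ 4 * B * Real.sqrt Z * Real.sqrt D :=
    b1.trans ((mul_le_mul hcθ hsq1 (Real.sqrt_nonneg _) (by positivity)).trans (le_of_eq (by ring)))
  have e2 : |∫ x, ⟪curl v x, fderiv ℝ θ x (curl v x)⟫| ≤ 4 * B * Real.sqrt Z * Real.sqrt D :=
    b2.trans ((mul_le_mul_of_nonneg_left hsq2 hZ0).trans (le_of_eq (by ring)))
  have e3 : |∫ x, ⟪curl v x, fderiv ℝ v x (curl θ x)⟫| ≤ 4 * B * Real.sqrt Z * Real.sqrt D :=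
    b3.trans ((mul_le_mul_of_nonneg_left hsq3 hZ0).trans (le_of_eq (by ring)))
  calc |(∫ x, ⟪curl θ x, fderiv ℝ v x (curl v x)⟫) + (∫ x, ⟪curl v x, fderiv ℝ θ x (curl v x)⟫) +
        (∫ x, ⟪curl v x, fderiv ℝ v x (curl θ x)⟫)|
      ≤ |∫ x, ⟪curl θ x, fderiv ℝ v x (curl v x)⟫| + |∫ x, ⟪curl v x, fderiv ℝ θ x (curl v x)⟫| +
        |∫ x, ⟪curl v x, fderiv ℝ v x (curl θ x)⟫| := (abs_add_le _ _).trans (add_le_add (abs_add_le _ _) le_rfl)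
    _ ≤ 4 * B * Real.sqrt Z * Real.sqrt D + 4 * B * Real.sqrt Z * Real.sqrt D + 4 * B * Real.sqrt Z * Real.sqrt D :=
        add_le_add (add_le_add e1 e2) e3
    _ = 12 * B * Real.sqrt Z * Real.sqrt D := by ring

end ExtremiserLiouville

end Summit.NavierStokesRegularity.NavierStokesRegularity.Theorems

end
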